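import Literature.AnabelianGeometry.SemiGraphs.TemperedDecompositionSubgroups
import Literature.AnabelianGeometry.SemiGraphs.ChartFibreProfiniteCompletion
import Literature.AnabelianGeometry.SemiGraphs.CuspOmissionSubgraph
import Literature.AnabelianGeometry.SemiGraphs.Corollary27iHoldsViaDecompositionGroups
import Literature.AnabelianGeometry.SemiGraphs.TemperedCompletionExistence
import Literature.AnabelianGeometry.Anabelioids.AutOfEquivalence
import HarnessLib

/-!
# `Π̂_ℍ := closure ι(Π^tp_ℍ)` is commensurably terminal in `Π̂_𝔾` — the profinite side of the decomposition
# subgroups of a sub-semi-graph ([IUTchI] §2 p. 44, Prop. 2.2; [SemiAnbd] Prop. 3.6 (iii)/(iv), Cor. 2.7 (i))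

Mochizuki, *Inter-universal Teichmüller theory I*, §2 p. 44 l. 39–44 ("decomposition groups `Π^tp_ℍ ⊆ Π^tp_𝔾`,
`Π̂_ℍ ⊆ Π̂_𝔾` … well-defined up to conjugation") and Prop. 2.2, proof p. 46 l. 9–11 ("by the evident pro-`Σ̂`
analogue of [SemiAnbd], Corollary 2.7, (i) … we have `C_{Π̂_𝔾}(Π̂_ℍ) = Π̂_ℍ`") [cite: Mochizuki2012, IUTchI Prop 2.2 p.46]
(`[claim: Mochizuki2012, status: disputed]` — nothing of the series is asserted); Mochizuki, *Semi-graphs of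
anabelioids*, Publ. RIMS **42** (2006), Prop. 3.6 (iii) p. 38 (`π₁^temp(G) → π̂₁(G)` is the profinite completion),
Prop. 3.6 (iv) p. 39 (functoriality), Def. 2.1 p. 24 (`Π_ℍ → Π_𝒢`), Cor. 2.7 (i) p. 30
[cite: MochizukiSemiAnbd2006, Cor. 2.7(i) p.30].

PROOF-ONLY file (abc-iut cell, layer L3, row «DECOMP-PROFINITE» = sub-row (P3) of GAP row G-w5d028-2; seat
abc-iut-w5-d240 gen 6; no definition, no instance, no new named fact).  For a chart `c` of `π₁^temp(𝒢)`, a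
sub-semi-graph `ℍ`, and a DECOMPOSITION SUBGROUP `D = Π^tp_ℍ ∈ c.decompSubgroups ℍ` (abc-iut-w4-d052,
`TemperedDecompositionSubgroups.lean`: `D = range φ` for a decomposition homomorphism `φ : π₁^temp(𝒢_ℍ) → π₁^temp(𝒢)`
with `B^temp(φ) ≅ c⁻¹ ⋙ (−)|_ℍ ⋙ c'`), the CLOSURE of `ι(D)` in ANY profinite completion `ι : π₁^temp(𝒢) → Π̂`
(`IsProfiniteCompletion`, e.g. abc-iut-L5's `TemperedGraphGroupData.exists_completion_of_prop36`) is
COMMENSURABLY TERMINAL — the consumer's hypothesis `hhat : IsCommensurablyTerminal HatH` of the [IUTchI] Cor. 2.3 (i)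
rows (abc-iut-w5-d028 `cor23i_iff_graph` / `cor23i_ofSpecialFibre_closureH_iff`, second conjunct) at
`HatH := closure ι(TpH)`, for every CONNECTED `ℍ` with a vertex (not only `ℍ = {v}`).  Chain (every link a kernel
theorem of the tree, consumed BY NAME): (A0) `B((𝒢_ℍ)) = B(𝒢)_ℍ` and `(−)|_ℍ ⋙ ofBObjTemp = ofBObjTemp ⋙ btempRestrict ℍ`
DEFINITIONALLY; (A1) `exists_chartFibreFin_iso_of_isDecompHom` — the restriction analogue of abc-iut's
`Hom.chartFibreFinPullbackIso` / `chartAction_pullback`: a `φ`-EQUIVARIANT `J : chartFibreFin c ≅ (−)|_ℍ ⋙ chartFibreFin c'`,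
whence for `φ̂ := J⁻¹-conjugation ∘ π₁((−)|_ℍ) : π̂₁(B(𝒢_ℍ)) → π̂₁(B(𝒢))` **`φ̂ ∘ ι' = ι ∘ φ` on the nose**
(`conjAut_pi1Map_chartActionFin`; `ι = chartActionFin c`, `ι' = chartActionFin c'` the completion maps of [SemiAnbd]
Prop. 3.6 (iii), `isProfiniteCompletion_chartActionFin`); (A2) `topologicalClosure_map_range_eq_range` —
**`closure ι(D) = range φ̂`** (`denseRange_chartActionFin`, compactness); (A3) `exists_mulEquiv_range_map_eq_range_piHToPi`
— change of basepoint inside `B(𝒢_ℍ)` (`chartFibreFinIsoρ`): `Aut(chart basepoint) ≅ Π_𝒢` carrying `range φ̂` EXACTLY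
onto `range (Π_ℍ → Π_𝒢)` (`piHToPi`); (A4) `isCommensurablyTerminal_range_conjAut_pi1Map` — [SemiAnbd] Cor. 2.7 (i)
`corollary_2_7_i_holds` (F-1458, kernel theorem) via abc-iut-L3-t1's cusp-omission form
`isCommensurablyTerminal_range_piHToPi_of_corollary_2_7_i`; (A5)
**`TemperedPiChart.isCommensurablyTerminal_topologicalClosure_map_of_mem_decompSubgroups`** — transport to ANY profinite
completion by uniqueness (`IsProfiniteCompletion.nonempty_continuousMulEquiv`), and the `∀ D ∈ decompSubgroups` form.

HYPOTHESES DISPLAYED (no Prop fact): `Prop36Hypotheses` of `𝒢` AND of `𝒢_ℍ` (charts' vertex data / finiteness of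
chart fibres / density), the two [IUTchI] p. 44 atoms of abc-iut-L3-t1's form (`hq`: the cusp-omitted graph of
anabelioids quasi-coherent; `hel`: the vertices of `ℍ` elevated there).  HONEST RESIDUAL (row (P1) of G-w5d028-2,
NOT proved here): «`ι⁻¹(closure ι(D)) = D`», i.e. `Π^tp_ℍ` is closed for the profinite topology of `Π^tp_𝔾`
([IUTchI] Cor. 2.3 (v), proof p. 49 l. 38 – p. 50 l. 2: at every finite étale level `Π^tp_ℍ` meets the discrete free
quotient in a FREE FACTOR, closed by M. Hall); (A1)–(A2) give only `D ≤ ι⁻¹(range φ̂)`; the missing lemma is the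
level structure «`D ∩` (finite-level discrete quotient) is a free factor», not a published prerequisite gap.
Nothing here takes a side on [IUTchIII] Cor. 3.12; typed ≠ proved for the [IUTchI] claim keys.
-/

noncomputable section

namespace Literature.AnabelianGeometry.SemiGraphs

namespace ProfiniteSemiGraph

open CategoryTheory CategoryTheory.Limits CategoryTheory.PreGaloisCategory
open Literature.AnabelianGeometry.Anabelioids
open Literature.AlgebraicGeometry.Frobenioids (BCat)
open scoped FintypeCatDiscrete Pointwise
open _root_.Topology

universe u

variable {𝒢 : ProfiniteSemiGraph.{u}} (H : 𝒢.graph.Subgraph)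

/-! ### (A0) Definitional squares for the restriction to a sub-semi-graph -/

/-- `B(𝒢_ℍ)` in the §2 presentation: the semi-graph of anabelioids of the restricted semi-graph of
profinite groups IS the restricted semi-graph of anabelioids (definitional).
[cite: MochizukiSemiAnbd2006, Def. 2.1 p.24] -/
theorem restrict_toAnab : (𝒢.restrict H).toAnab = 𝒢.toAnab.restrict H := rfl

/-- Restricting a finite étale covering to `ℍ` and regarding it as a tempered covering of `𝒢_ℍ` is
regarding it as a tempered covering of `𝒢` and restricting: `(−)|_ℍ ⋙ ofBObjTemp = ofBObjTemp ⋙ btempRestrict ℍ`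
(definitional). [cite: MochizukiSemiAnbd2006, Def 3.5(ii) p.37] -/
theorem restrictFunctor_comp_ofBObjTemp (h𝒢 : ∀ S : CovObj 𝒢, S.IsFinite → S.IsTempered)
    (hH : ∀ S : CovObj (𝒢.restrict H), S.IsFinite → S.IsTempered) :
    (𝒢.toAnab.restrictFunctor H : 𝒢.toAnab.BObj ⥤ (𝒢.restrict H).toAnab.BObj) ⋙
        (𝒢.restrict H).ofBObjTemp hH =
      𝒢.ofBObjTemp h𝒢 ⋙ 𝒢.btempRestrict H := rfl


/-! ### (A1) The canonical transport of chart basepoints along the restriction, and `φ̂` -/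

section DecompHat

variable {H}
variable (c : TemperedPiChart 𝒢) (c' : TemperedPiChart (𝒢.restrict H)) {φ : c'.G →ₜ* c.G}
  (h𝒢 : ∀ S : CovObj 𝒢, S.IsFinite → S.IsTempered)
  (hH : ∀ S : CovObj (𝒢.restrict H), S.IsFinite → S.IsTempered)
  (hfin : ∀ X : 𝒢.toAnab.BObj, Finite ((chartFibre c h𝒢).obj X))
  (hfin' : ∀ X : (𝒢.restrict H).toAnab.BObj, Finite ((chartFibre c' hH).obj X))

/-- **The canonical transport of chart basepoints along the restriction to `ℍ`** ([SemiAnbd] Prop. 3.6 (iv)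
p. 39; pattern of `Hom.chartFibreFinPullbackIso` for the restriction functor `B(𝒢) → B(𝒢_ℍ)`): a decomposition
homomorphism `φ` WITH its defining isomorphism `i` yields a `φ`-EQUIVARIANT isomorphism
`J : chartFibreFin c ≅ (−)|_ℍ ⋙ chartFibreFin c'` of fibre functors of `B(𝒢)`. [cite: MochizukiSemiAnbd2006, Prop 3.6(iv) p.39] -/
theorem exists_chartFibreFin_iso_of_isDecompHom
    (i : c.equiv.inverse ⋙ 𝒢.btempRestrict H ⋙ c'.equiv.functor ≅ BTemp.res φ) :
    ∃ J : chartFibreFin c h𝒢 hfin ≅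
        (𝒢.toAnab.restrictFunctor H ⋙ 𝟭 ((𝒢.restrict H).toAnab.BObj)) ⋙
          chartFibreFin c' hH hfin',
      ∀ (g' : c'.G) (X : 𝒢.toAnab.BObj) (y : (chartFibreFin c h𝒢 hfin).obj X),
        J.hom.app X ((chartActionFin c h𝒢 hfin (φ g')).hom.app X y) =
          (chartActionFin c' hH hfin' g').hom.app ((𝒢.toAnab.restrictFunctor H).obj X)
            (J.hom.app X y) := by
  -- the tempered-level isomorphism `ofBObjTemp ⋙ c ⋙ B^temp(φ) ≅ (−)|_ℍ ⋙ ofBObjTemp ⋙ c'`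
  let e : 𝒢.ofBObjTemp h𝒢 ⋙ c.equiv.functor ⋙ BTemp.res φ ≅
      (𝒢.toAnab.restrictFunctor H ⋙ 𝟭 ((𝒢.restrict H).toAnab.BObj)) ⋙
        (𝒢.restrict H).ofBObjTemp hH ⋙ c'.equiv.functor :=
    Functor.isoWhiskerLeft _ (Functor.isoWhiskerLeft _ i.symm) ≪≫
      Functor.isoWhiskerLeft _ (Functor.associator _ _ _).symm ≪≫
      Functor.isoWhiskerLeft _ (Functor.isoWhiskerRight c.equiv.unitIso.symm _) ≪≫
      Functor.isoWhiskerLeft _ (Functor.leftUnitor _) ≪≫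
      (Functor.associator _ _ _).symm ≪≫
      Functor.isoWhiskerRight
        (Iso.refl _ : 𝒢.ofBObjTemp h𝒢 ⋙ 𝒢.btempRestrict H ≅
          (𝒢.toAnab.restrictFunctor H ⋙ 𝟭 ((𝒢.restrict H).toAnab.BObj)) ⋙
            (𝒢.restrict H).ofBObjTemp hH) c'.equiv.functor ≪≫
      Functor.associator _ _ _
  -- forget to underlying sets: `chartFibre c ≅ (−)|_ℍ ⋙ chartFibre c'`
  let J₀ : chartFibre c h𝒢 ≅
      (𝒢.toAnab.restrictFunctor H ⋙ 𝟭 ((𝒢.restrict H).toAnab.BObj)) ⋙ chartFibre c' hH :=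
    Functor.isoWhiskerRight e ((temperedAction c'.G).ι ⋙ Action.forget (Type u) c'.G)
  -- descend along the fully faithful `FintypeCat ⥤ Type`
  let J : chartFibreFin c h𝒢 hfin ≅
      (𝒢.toAnab.restrictFunctor H ⋙ 𝟭 ((𝒢.restrict H).toAnab.BObj)) ⋙
        chartFibreFin c' hH hfin' :=
    ((ObjectProperty.fullyFaithfulι (fun X : Type u => Finite X)).whiskeringRight _).preimageIso J₀
  refine ⟨J, fun g' X y => ?_⟩
  -- `(e.hom.app X)` is a morphism of `B^temp(π₁^temp(𝒢_ℍ))`, hence `φ`-equivariant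
  exact ConcreteCategory.congr_hom ((e.hom.app X).hom.comm g') y

variable {c c' h𝒢 hH hfin hfin'}

/-- **`φ̂ ∘ ι' = ι ∘ φ` on the nose** ([SemiAnbd] Prop. 3.6 (iv) with (iii), the restriction analogue of
`Hom.piHatMap_chartActionFin`): for `φ̂ := J⁻¹-conjugation ∘ π₁((−)|_ℍ)`, the homomorphism
`π̂₁(B(𝒢_ℍ)) → π̂₁(B(𝒢))` of profinite fundamental groups at the chart basepoints, and the
completion maps `ι = chartActionFin c`, `ι' = chartActionFin c'`. [cite: MochizukiSemiAnbd2006, Prop 3.6(iv) p.39] -/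
theorem conjAut_pi1Map_chartActionFin
    (J : chartFibreFin c h𝒢 hfin ≅
      (𝒢.toAnab.restrictFunctor H ⋙ 𝟭 ((𝒢.restrict H).toAnab.BObj)) ⋙
        chartFibreFin c' hH hfin')
    (hJ : ∀ (g' : c'.G) (X : 𝒢.toAnab.BObj) (y : (chartFibreFin c h𝒢 hfin).obj X),
      J.hom.app X ((chartActionFin c h𝒢 hfin (φ g')).hom.app X y) =
        (chartActionFin c' hH hfin' g').hom.app ((𝒢.toAnab.restrictFunctor H).obj X) (J.hom.app X y))
    (g' : c'.G) :
    (J.symm.conjAut.toMonoidHom.comp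
        (pi1Map (𝒢.toAnab.restrictFunctor H ⋙ 𝟭 ((𝒢.restrict H).toAnab.BObj))
          (chartFibreFin c' hH hfin')))
      (chartActionFin c' hH hfin' g') = chartActionFin c h𝒢 hfin (φ g') := by
  apply Iso.ext
  apply NatTrans.ext
  funext X
  apply ConcreteCategory.hom_ext
  intro y
  change ((J.symm.conjAut (pi1Map _ (chartFibreFin c' hH hfin')
    (chartActionFin c' hH hfin' g'))).hom.app
    X) y = _
  rw [Iso.conjAut_hom, Iso.conj_apply]
  change J.inv.app X ((chartActionFin c' hH hfin' g').hom.app ((𝒢.toAnab.restrictFunctor H).obj X)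
    (J.hom.app X y)) = _
  rw [← hJ g' X y]
  exact Iso.hom_inv_id_app_apply J X _

/-- Conjugation by an isomorphism of finite-valued functors is continuous for the profinite topologies
on their automorphism groups (coordinatewise on `∏_X Aut (F X)`). [folklore] -/
private theorem continuous_conjAut {C : Type*} [Category C] {F F' : C ⥤ FintypeCat.{u}} (e : F ≅ F') :
    Continuous e.conjAut := by
  rw [(autEmbedding_isClosedEmbedding F').isInducing.continuous_iff, continuous_pi_iff]
  intro X
  have hco : (fun σ : Aut F => autEmbedding F' (e.conjAut σ) X) =
      fun σ => (e.app X).conjAut (autEmbedding F σ X) := by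
    funext σ
    refine Iso.ext ?_
    simp [Iso.conj_apply, autEmbedding_apply]
  change Continuous fun σ : Aut F => autEmbedding F' (e.conjAut σ) X
  rw [hco]
  exact continuous_of_discreteTopology.comp
    ((continuous_apply X).comp (autEmbedding_isClosedEmbedding F).continuous)

/-- **`φ̂` is continuous.** [cite: MochizukiSemiAnbd2006, Prop 3.6(iv) p.39] -/
theorem continuous_conjAut_pi1Map
    (J : chartFibreFin c h𝒢 hfin ≅
      (𝒢.toAnab.restrictFunctor H ⋙ 𝟭 ((𝒢.restrict H).toAnab.BObj)) ⋙
        chartFibreFin c' hH hfin') :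
    Continuous (J.symm.conjAut.toMonoidHom.comp
      (pi1Map (𝒢.toAnab.restrictFunctor H ⋙ 𝟭 ((𝒢.restrict H).toAnab.BObj))
        (chartFibreFin c' hH hfin'))) :=
  (continuous_conjAut J.symm).comp (continuous_pi1Map' _ _)

/-! ### (A2) Closure of the image of `Π^tp_ℍ` = image of `π̂₁(B(𝒢_ℍ))` -/

/-- A continuous map from a compact space to a Hausdorff space carries the closure of a dense set —
i.e. everything — onto the closure of its image: `closure (f '' s) = range f`. [folklore] -/
private theorem closure_image_eq_range_of_dense {P Q : Type*} [TopologicalSpace P] [TopologicalSpace Q]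
    [CompactSpace P] [T2Space Q] {f : P → Q} (hf : Continuous f) {s : Set P} (hs : Dense s) :
    closure (f '' s) = Set.range f := by
  apply le_antisymm
  · exact closure_minimal (Set.image_subset_range f s) (isCompact_range hf).isClosed
  · calc Set.range f = f '' closure s := by rw [hs.closure_eq, Set.image_univ]
      _ ⊆ closure (f '' s) := image_closure_subset_closure_image hf

/-- **`closure ι(Π^tp_ℍ) = φ̂(π̂₁(B(𝒢_ℍ)))`**: the closure in `π̂₁(B(𝒢))` of the image of the
decomposition subgroup `range φ` under the completion map `ι = chartActionFin c` is the image of the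
compact group `π̂₁(B(𝒢_ℍ))` under `φ̂` — because `ι' = chartActionFin c'` has dense range
([SemiAnbd] Prop. 3.6 (iii), `denseRange_chartActionFin`) and `φ̂ ∘ ι' = ι ∘ φ`.
[cite: MochizukiSemiAnbd2006, Prop 3.6(iii) p.38] -/
theorem topologicalClosure_map_range_eq_range
    (J : chartFibreFin c h𝒢 hfin ≅
      (𝒢.toAnab.restrictFunctor H ⋙ 𝟭 ((𝒢.restrict H).toAnab.BObj)) ⋙
        chartFibreFin c' hH hfin')
    (hJ : ∀ (g' : c'.G) (X : 𝒢.toAnab.BObj) (y : (chartFibreFin c h𝒢 hfin).obj X),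
      J.hom.app X ((chartActionFin c h𝒢 hfin (φ g')).hom.app X y) =
        (chartActionFin c' hH hfin' g').hom.app ((𝒢.toAnab.restrictFunctor H).obj X) (J.hom.app X y))
    (d' : ChartVertexDatum c') :
    ((φ.toMonoidHom.range).map (chartActionFin c h𝒢 hfin)).topologicalClosure =
      (J.symm.conjAut.toMonoidHom.comp
        (pi1Map (𝒢.toAnab.restrictFunctor H ⋙ 𝟭 ((𝒢.restrict H).toAnab.BObj))
          (chartFibreFin c' hH hfin'))).range := by
  apply SetLike.coe_injective
  rw [Subgroup.topologicalClosure_coe, Subgroup.coe_map, MonoidHom.coe_range, MonoidHom.coe_range,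
    ← Set.range_comp]
  have hsq : (chartActionFin c h𝒢 hfin : c.G → _) ∘ (φ.toMonoidHom : c'.G → c.G) =
      (J.symm.conjAut.toMonoidHom.comp
          (pi1Map _ (chartFibreFin c' hH hfin'))) ∘
        (chartActionFin c' hH hfin') := by
    funext g'
    exact (conjAut_pi1Map_chartActionFin J hJ g').symm
  rw [hsq, Set.range_comp]
  exact closure_image_eq_range_of_dense (continuous_conjAut_pi1Map J)
    (denseRange_chartActionFin c' hH hfin' d')


/-! ### (A3) Change of basepoint: `range φ̂` IS the decomposition group `Π_ℍ = range (Π_ℍ → Π_𝒢)` of [SemiAnbd] §2 -/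

/-- **`range φ̂ = Π_ℍ`** ([SemiAnbd] Def. 2.1 p. 24, `piHToPi`): along the vertex basepoint of `B(𝒢_ℍ)` through
`w ∈ ℍ` supplied by a verticial homomorphism `ψ'` of `c'` (`chartFibreFinIsoρ`), the isomorphism
`Aut(chart basepoint of B(𝒢)) ≅ Π_𝒢 = Aut(ρ_w ⋙ forget)` obtained by composing `J` with it carries `range φ̂` EXACTLY
onto the range of `Π_ℍ → Π_𝒢` (both are `π₁((−)|_ℍ)`; the two basepoints of `B(𝒢_ℍ)` differ by `δ'`, absorbed).
[cite: MochizukiSemiAnbd2006, Def. 2.1 p.24] -/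
theorem exists_mulEquiv_range_map_eq_range_piHToPi
    (J : chartFibreFin c h𝒢 hfin ≅
      (𝒢.toAnab.restrictFunctor H ⋙ 𝟭 ((𝒢.restrict H).toAnab.BObj)) ⋙ chartFibreFin c' hH hfin')
    (w : H.toSemiGraph.Vertex) (ψ' : (𝒢.restrict H).Gv w →ₜ* c'.G)
    (e' : c'.equiv.inverse ⋙ ObjectProperty.ι _ ⋙ restrictV (𝒢.restrict H) w ≅ BTemp.res ψ') :
    ∃ γ : Aut (chartFibreFin c h𝒢 hfin) ≃*
        𝒢.toAnab.Pi w.1 (ObjectProperty.ι (Action.IsContinuous (V := FintypeCat.{u}) (G := 𝒢.Gv w.1)) ⋙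
          Action.forget FintypeCat.{u} (𝒢.Gv w.1)),
      ((J.symm.conjAut.toMonoidHom.comp
          (pi1Map (𝒢.toAnab.restrictFunctor H ⋙ 𝟭 ((𝒢.restrict H).toAnab.BObj))
            (chartFibreFin c' hH hfin'))).range).map γ.toMonoidHom =
        (𝒢.toAnab.piHToPi H w
          (ObjectProperty.ι (Action.IsContinuous (V := FintypeCat.{u}) (G := 𝒢.Gv w.1)) ⋙
            Action.forget FintypeCat.{u} (𝒢.Gv w.1))).range := by
  -- the vertex basepoint of `B(𝒢_ℍ)` through `w`, and its comparison with the chart basepoint of `c'`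
  let Fv := ObjectProperty.ι (Action.IsContinuous (V := FintypeCat.{u}) (G := 𝒢.Gv w.1)) ⋙
    Action.forget FintypeCat.{u} (𝒢.Gv w.1)
  let δ' : chartFibreFin c' hH hfin' ≅ (𝒢.restrict H).toAnab.ρ w ⋙ Fv := chartFibreFinIsoρ c' hH hfin' w ψ' e'
  let R := 𝒢.toAnab.restrictFunctor H ⋙ 𝟭 ((𝒢.restrict H).toAnab.BObj)
  let γ : chartFibreFin c h𝒢 hfin ≅ 𝒢.toAnab.ρ w.1 ⋙ Fv := J ≪≫ Functor.isoWhiskerLeft R δ'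
  let φhat := J.symm.conjAut.toMonoidHom.comp (pi1Map R (chartFibreFin c' hH hfin'))
  -- KEY: `γ`-transport of `φ̂ σ'` is `π₁((−)|_ℍ)` of the `δ'`-transport of `σ'`, on the nose
  have key : ∀ σ', Aut.autMulEquivOfIso γ (φhat σ') = 𝒢.toAnab.piHToPi H w Fv (δ'.conjAut σ') := by
    intro σ'
    apply Iso.ext
    apply NatTrans.ext
    funext X
    change (γ.inv ≫ (J.symm.conjAut (pi1Map R (chartFibreFin c' hH hfin') σ')).hom ≫ γ.hom).app X =
      (δ'.conjAut σ').hom.app (R.obj X)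
    simp only [γ, Iso.trans_hom, Iso.trans_inv, Functor.isoWhiskerLeft_hom, Functor.isoWhiskerLeft_inv,
      Iso.conjAut_hom, Iso.conj_apply, Iso.symm_hom, Iso.symm_inv, NatTrans.comp_app,
      Functor.whiskerLeft_app, pi1Map_hom_app, Category.assoc, Iso.inv_hom_id_app_assoc]
    rfl
  refine ⟨Aut.autMulEquivOfIso γ, ?_⟩
  ext τ
  simp only [Subgroup.mem_map, MonoidHom.mem_range, MulEquiv.coe_toMonoidHom]
  constructor
  · rintro ⟨_, ⟨σ', rfl⟩, rfl⟩
    exact ⟨δ'.conjAut σ', (key σ').symm⟩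
  · rintro ⟨σ'', rfl⟩
    refine ⟨φhat (δ'.conjAut.symm σ''), ⟨_, rfl⟩, ?_⟩
    exact (key _).trans (congrArg (𝒢.toAnab.piHToPi H w Fv) (δ'.conjAut.apply_symm_apply σ''))


/-! ### (A4) Commensurable terminality of `range φ̂` from [SemiAnbd] Cor. 2.7 (i) BY NAME -/

/-- **`C(range φ̂) = range φ̂` in `π̂₁(B(𝒢))`** — [SemiAnbd] Cor. 2.7 (i) (`corollary_2_7_i_holds`, F-1458, a
kernel theorem) in abc-iut-L3-t1's form for semi-graphs WITH cusps
(`isCommensurablyTerminal_range_piHToPi_of_corollary_2_7_i`: `𝒢` connected, the cusp-omitted graph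
`𝒢_{𝔾_max}` quasi-coherent, `ℍ` connected with the vertex `w`, the vertices of `ℍ` elevated in `𝒢_{𝔾_max}`),
transported along the exact identification `γ` of `exists_mulEquiv_range_map_eq_range_piHToPi`.
[cite: MochizukiSemiAnbd2006, Cor. 2.7(i) p.30] -/
theorem isCommensurablyTerminal_range_conjAut_pi1Map
    (J : chartFibreFin c h𝒢 hfin ≅
      (𝒢.toAnab.restrictFunctor H ⋙ 𝟭 ((𝒢.restrict H).toAnab.BObj)) ⋙ chartFibreFin c' hH hfin')
    (h𝒢c : 𝒢.graph.IsConnected) (hq : (𝒢.toAnab.restrict 𝒢.toAnab.graph.maximalSubgraph).IsQuasiCoherent)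
    (hHc : H.toSemiGraph.IsConnected) (w : H.toSemiGraph.Vertex) (ψ' : (𝒢.restrict H).Gv w →ₜ* c'.G)
    (e' : c'.equiv.inverse ⋙ ObjectProperty.ι _ ⋙ restrictV (𝒢.restrict H) w ≅ BTemp.res ψ')
    (hel : ∀ v : H.toSemiGraph.Vertex,
      (𝒢.toAnab.restrict 𝒢.toAnab.graph.maximalSubgraph).IsElevated ⟨v.1, trivial⟩) :
    AbsoluteAnabelian.IsCommensurablyTerminal
      (J.symm.conjAut.toMonoidHom.comp
        (pi1Map (𝒢.toAnab.restrictFunctor H ⋙ 𝟭 ((𝒢.restrict H).toAnab.BObj))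
          (chartFibreFin c' hH hfin'))).range := by
  obtain ⟨γ, hγ⟩ := exists_mulEquiv_range_map_eq_range_piHToPi J w ψ' e'
  have h27 := @SemiGraphOfAnabelioids.isCommensurablyTerminal_range_piHToPi_of_corollary_2_7_i 𝒢.toAnab
    SemiGraphOfAnabelioids.corollary_2_7_i_holds ⟨h𝒢c⟩ hq H hHc w hel
    (ObjectProperty.ι (Action.IsContinuous (V := FintypeCat.{u}) (G := 𝒢.Gv w.1)) ⋙
      Action.forget FintypeCat.{u} (𝒢.Gv w.1))
    (fiberFunctor_forget_bCat (𝒢.Gv w.1))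
  rw [← hγ] at h27
  exact (isCommensurablyTerminal_map_iff_of_bijective γ.toMonoidHom γ.bijective _).1 h27

end DecompHat

/-! ### (A5) `Π̂_ℍ := closure ι(Π^tp_ℍ)` is commensurably terminal — every profinite completion `ι`, every
decomposition subgroup `Π^tp_ℍ ∈ decompSubgroups c ℍ` -/

/-- A homeomorphic group isomorphism carries topological closures of subgroups to topological closures.
[folklore] -/
private theorem map_topologicalClosure_eq_of_continuousMulEquiv {A B : Type*} [Group A] [TopologicalSpace A]
    [IsTopologicalGroup A] [Group B] [TopologicalSpace B] [IsTopologicalGroup B] (e : A ≃ₜ* B)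
    (K : Subgroup A) : (K.topologicalClosure).map e.toMulEquiv.toMonoidHom = (K.map e.toMulEquiv.toMonoidHom).topologicalClosure := by
  apply SetLike.coe_injective
  rw [Subgroup.coe_map, Subgroup.topologicalClosure_coe, Subgroup.topologicalClosure_coe, Subgroup.coe_map]
  exact e.toHomeomorph.image_closure (K : Set A)

namespace TemperedPiChart

/-- **[IUTchI] Prop. 2.2's cited input `C_{Π̂_𝔾}(Π̂_ℍ) = Π̂_ℍ` as a THEOREM for the decomposition subgroups of a
connected sub-semi-graph** (§2 p. 44; Prop. 2.2 proof p. 46 "by the evident pro-`Σ̂` analogue of [SemiAnbd],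
Corollary 2.7, (i)"): for `𝒢`, `𝒢_ℍ` satisfying the hypotheses of [SemiAnbd] Prop. 3.6, the cusp-omitted graph of
anabelioids quasi-coherent with the vertices of `ℍ` elevated, ANY profinite completion `ι : π₁^temp(𝒢) → Π̂` of a chart
`c` and ANY `D = Π^tp_ℍ ∈ c.decompSubgroups ℍ`, the closed subgroup `Π̂_ℍ := closure ι(D)` of `Π̂` is COMMENSURABLY
TERMINAL (chain (A1)–(A4) at the chart model `Aut(chart basepoint)`, then uniqueness of profinite completions).  The
[IUTchI] sentence is a `[claim: Mochizuki2012, status: disputed]` item; PROVED is the displayed group-theoretic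
statement over the tree's definitions. [cite: Mochizuki2012, IUTchI Prop 2.2 p.46] -/
theorem isCommensurablyTerminal_topologicalClosure_map_of_mem_decompSubgroups
    {H : 𝒢.graph.Subgraph} (h36 : 𝒢.Prop36Hypotheses) (h36' : (𝒢.restrict H).Prop36Hypotheses)
    (hq : (𝒢.toAnab.restrict 𝒢.toAnab.graph.maximalSubgraph).IsQuasiCoherent)
    (hel : ∀ v : H.toSemiGraph.Vertex,
      (𝒢.toAnab.restrict 𝒢.toAnab.graph.maximalSubgraph).IsElevated ⟨v.1, trivial⟩)
    (c : TemperedPiChart 𝒢) {P : Type*} [Group P] [TopologicalSpace P] [IsTopologicalGroup P]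
    {ι : c.G →ₜ* P} (hι : IsProfiniteCompletion ι) {D : Subgroup c.G} (hD : D ∈ c.decompSubgroups H) :
    AbsoluteAnabelian.IsCommensurablyTerminal ((D.map ι.toMonoidHom).topologicalClosure) := by
  obtain ⟨c', φ, ⟨i⟩, rfl⟩ := hD
  haveI := c.isTopologicalGroup
  -- the chart models of the profinite completions of `π₁^temp(𝒢)`, `π₁^temp(𝒢_ℍ)`
  have h𝒢 := isTempered_of_isFinite_of_prop36 h36
  have hH := isTempered_of_isFinite_of_prop36 h36'
  obtain ⟨d⟩ := nonempty_chartVertexDatum h36 c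
  obtain ⟨d'⟩ := nonempty_chartVertexDatum h36' c'
  have hfin : ∀ X : 𝒢.toAnab.BObj, Finite ((chartFibre c h𝒢).obj X) :=
    fun X => finite_chartFibre c h𝒢 d.v d.ψ d.e X
  have hfin' : ∀ X : (𝒢.restrict H).toAnab.BObj, Finite ((chartFibre c' hH).obj X) :=
    fun X => finite_chartFibre c' hH d'.v d'.ψ d'.e X
  obtain ⟨J, hJ⟩ := exists_chartFibreFin_iso_of_isDecompHom c c' h𝒢 hH hfin hfin' i
  -- `range φ̂` is commensurably terminal ([SemiAnbd] Cor. 2.7 (i)) and equals `closure ι₁(range φ)`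
  have hct := isCommensurablyTerminal_range_conjAut_pi1Map J h36.isConnected hq h36'.isConnected d'.v d'.ψ
    d'.e hel
  rw [← topologicalClosure_map_range_eq_range J hJ d'] at hct
  -- transport from the chart model `ι₁ = chartActionFin c` to the given completion `ι`
  have h₁ := isProfiniteCompletion_chartActionFin c h𝒢 hfin d
  obtain ⟨e, he⟩ := IsProfiniteCompletion.nonempty_continuousMulEquiv h₁ hι
  have hmap : (φ.toMonoidHom.range).map ι.toMonoidHom =
      ((φ.toMonoidHom.range).map (chartActionFin c h𝒢 hfin)).map e.toMulEquiv.toMonoidHom := by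
    rw [Subgroup.map_map]
    congr 1
    ext g
    exact (he g).symm
  rw [hmap, ← map_topologicalClosure_eq_of_continuousMulEquiv]
  exact (isCommensurablyTerminal_map_iff_of_bijective e.toMulEquiv.toMonoidHom e.toMulEquiv.bijective _).2
    hct

/-- The same for EVERY decomposition subgroup at once (the quantifier shape of abc-iut-w4-d052's named
target `DecompSubgroupsCommensurablyTerminal`, here on the PROFINITE side).
[cite: Mochizuki2012, IUTchI Prop 2.2 p.46] -/
theorem forall_isCommensurablyTerminal_topologicalClosure_map_decompSubgroups
    {H : 𝒢.graph.Subgraph} (h36 : 𝒢.Prop36Hypotheses) (h36' : (𝒢.restrict H).Prop36Hypotheses)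
    (hq : (𝒢.toAnab.restrict 𝒢.toAnab.graph.maximalSubgraph).IsQuasiCoherent)
    (hel : ∀ v : H.toSemiGraph.Vertex,
      (𝒢.toAnab.restrict 𝒢.toAnab.graph.maximalSubgraph).IsElevated ⟨v.1, trivial⟩)
    (c : TemperedPiChart 𝒢) {P : Type*} [Group P] [TopologicalSpace P] [IsTopologicalGroup P]
    {ι : c.G →ₜ* P} (hι : IsProfiniteCompletion ι) :
    ∀ D ∈ c.decompSubgroups H, AbsoluteAnabelian.IsCommensurablyTerminal ((D.map ι.toMonoidHom).topologicalClosure) :=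
  fun _ hD => isCommensurablyTerminal_topologicalClosure_map_of_mem_decompSubgroups h36 h36' hq hel c hι hD

end TemperedPiChart

end ProfiniteSemiGraph

end Literature.AnabelianGeometry.SemiGraphs

end
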